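import Summits.Ventures.PercRepro.C041ZoneOCubeCountDefs
import Summits.Ventures.PercRepro.C041ZoneOCubeOneSided

/-!
# ROW C-041 — the NODE of a tree zone in the abstract zone model (p6, gen 29; C-041.md §15 (c), (i), §19 (h))

The bridge between mine-3's recursive tree-zone model (`TZ`, `C041TreeStates`) and the graph model of the zones
(`ZoneData`, `C041ZoneZDefs`) is built from ONE generic construction: a NODE — a root `none` carrying `p` 1-marks
and `q` 2-marks, joined by one edge `⟨j, none⟩` to the root `rc j` of each of `d` child zones `Zc j`, whose vertices,
edges and marks are embedded as `some ⟨j, ·⟩`, `⟨j, some ·⟩`, `Sum.inr ⟨j, ·⟩` (`nodeZone`).  A state of the node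
restricts to a state of every child (`restrict`); the marks of the node are read off the root and the children
(`none_mem_Bl_iff`, `some_mem_Bl_iff`, …), and so is EVERY REACH of the node (`none_mem_reach_iff`,
`some_mem_reach_iff`, for the adjacency of either colour and any source set `S`): the root is reached from `S` iff it
lies in `S` or some child root is reached from `S ∩ child` inside the child and its edge has the colour
(`rootReach`); a child vertex is reached iff it is reached inside its child, or its edge has the colour, it is
connected to the child root and the root is reached.  Also the generic RELATIVE admissibility `admR` («every sub-zone
other than the anchor's is admissible») with `adm ⟺ admR ∧ ¬ (anchor deleted on both sides)` (`adm_iff_admR`).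
The zone sets of the node (`D`, `D2`, `P`, `K`, `blueK`, `admR`) in terms of the children are the next module.
-/

namespace PercRepro

namespace ZoneZ

namespace ZoneData

variable {V E T₁ T₂ : Type*} (Z : ZoneData V E T₁ T₂) (k : V) (σ : State E T₁ T₂)

/-- RELATIVE admissibility: every sub-zone other than the anchor's is admissible — no blue `2`-mark outside the
anchor's sub-zone is deleted. -/
def admR : Prop := ∀ m ∈ Z.M σ, m ∉ Z.P {k} σ → m ∉ Z.D σ

/-- Admissibility is relative admissibility together with «the anchor is not deleted on both sides». -/
theorem adm_iff_admR : Z.adm σ ↔ Z.admR k σ ∧ ¬ (k ∈ Z.D σ ∧ k ∈ Z.D2 σ) := by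
  constructor
  · intro hadm
    refine ⟨fun m hm _ hmD => Set.disjoint_left.1 hadm hm hmD, fun h => ?_⟩
    exact Z.not_mem_D_of_mem_D2 k σ hadm h.2 h.1
  · rintro ⟨hR, hnot⟩
    rw [adm, Set.disjoint_left]
    intro m hm hmD
    by_cases hmP : m ∈ Z.P {k} σ
    · refine hnot ⟨?_, (Z.mem_D2_iff_inter k σ).2 ⟨m, hmP, hm⟩⟩
      exact reach_singleton_subset hmD (mem_reach_singleton_symm (Z.adj_symm _ σ) hmP)
    · exact hR m hm hmP hmD

end ZoneData

namespace TreeNode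

open ZoneData

universe u₁ u₂ u₃ u₄

variable {d : ℕ} {Vc : Fin d → Type u₁} {Ec : Fin d → Type u₂} {T₁c : Fin d → Type u₃} {T₂c : Fin d → Type u₄}

/-! ## The node zone -/

/-- The vertices of a node zone: the root `none`, or the vertex `x` of the child `j` as `some ⟨j, x⟩`. -/
abbrev NPos (Vc : Fin d → Type u₁) : Type u₁ := Option (Σ j, Vc j)

/-- The edges of a node zone: for every child `j` the edge `⟨j, none⟩` from the root to the child's root, and the
child's own edges `⟨j, some e⟩`. -/
abbrev NEdge (Ec : Fin d → Type u₂) : Type u₂ := Σ j, Option (Ec j)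

/-- The terminal edges of a node zone: `p` at the root (`Sum.inl`) and those of the children (`Sum.inr ⟨j, m⟩`). -/
abbrev NMark (p : ℕ) (Tc : Fin d → Type u₃) : Type u₃ := Fin p ⊕ Σ j, Tc j

/-- The vertex of a terminal edge of the node zone. -/
def nAt {Tc : Fin d → Type u₃} {p : ℕ} (atc : ∀ j, Tc j → Vc j) : NMark p Tc → NPos Vc
  | Sum.inl _ => none
  | Sum.inr ⟨j, m⟩ => some ⟨j, atc j m⟩

/-- The first end of an edge of the node zone (the root for the edge `⟨j, none⟩`). -/
def nFst (Zc : ∀ j, ZoneData (Vc j) (Ec j) (T₁c j) (T₂c j)) : NEdge Ec → NPos Vc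
  | ⟨_, none⟩ => none
  | ⟨j, some e⟩ => some ⟨j, (Zc j).fst e⟩

/-- The second end of an edge of the node zone (the child's root for the edge `⟨j, none⟩`). -/
def nSnd (Zc : ∀ j, ZoneData (Vc j) (Ec j) (T₁c j) (T₂c j)) (rc : ∀ j, Vc j) : NEdge Ec → NPos Vc
  | ⟨j, none⟩ => some ⟨j, rc j⟩
  | ⟨j, some e⟩ => some ⟨j, (Zc j).snd e⟩

/-- The NODE ZONE: a root with `p` 1-marks and `q` 2-marks, joined to the roots `rc j` of the child zones `Zc j`. -/
def nodeZone (Zc : ∀ j, ZoneData (Vc j) (Ec j) (T₁c j) (T₂c j)) (rc : ∀ j, Vc j) (p q : ℕ) :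
    ZoneData (NPos Vc) (NEdge Ec) (NMark p T₁c) (NMark q T₂c) :=
  ⟨nFst Zc, nSnd Zc rc, nAt (fun j => (Zc j).at₁), nAt (fun j => (Zc j).at₂)⟩

/-- The restriction of a state of the node zone to the child `j`. -/
def restrict {p q : ℕ} (σ : State (NEdge Ec) (NMark p T₁c) (NMark q T₂c)) (j : Fin d) :
    State (Ec j) (T₁c j) (T₂c j) :=
  (fun e => σ.1 ⟨j, some e⟩, fun m => σ.2.1 (Sum.inr ⟨j, m⟩), fun m => σ.2.2 (Sum.inr ⟨j, m⟩))

/-! ## Marks -/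

/-- A mark set of the node at the root: a mark of the root with the colour. -/
theorem none_mem_markSet_nAt {Tc : Fin d → Type u₃} {p : ℕ} (atc : ∀ j, Tc j → Vc j) (m : NMark p Tc → Bool)
    (b : Bool) : (none : NPos Vc) ∈ markSet (nAt atc) m b ↔ ∃ i, m (Sum.inl i) = b := by
  constructor
  · rintro ⟨t, ht, hm⟩
    rcases t with i | ⟨j, t⟩
    · exact ⟨i, hm⟩
    · exact absurd ht (by simp [nAt])
  · rintro ⟨i, hi⟩
    exact ⟨Sum.inl i, rfl, hi⟩

/-- A mark set of the node at a child vertex: the child's mark set. -/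
theorem some_mem_markSet_nAt {Tc : Fin d → Type u₃} {p : ℕ} (atc : ∀ j, Tc j → Vc j) (m : NMark p Tc → Bool)
    (b : Bool) (j : Fin d) (x : Vc j) :
    (some ⟨j, x⟩ : NPos Vc) ∈ markSet (nAt atc) m b ↔ x ∈ markSet (atc j) (fun t => m (Sum.inr ⟨j, t⟩)) b := by
  constructor
  · rintro ⟨t, ht, hm⟩
    rcases t with i | ⟨j', t⟩
    · exact absurd ht (by simp [nAt])
    · simp only [nAt, Option.some.injEq] at ht
      obtain ⟨rfl, h⟩ := Sigma.mk.inj_iff.1 ht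
      obtain rfl := eq_of_heq h
      exact ⟨t, rfl, hm⟩
  · rintro ⟨t, ht, hm⟩
    exact ⟨Sum.inr ⟨j, t⟩, by simp [nAt, ht], hm⟩

variable (Zc : ∀ j, ZoneData (Vc j) (Ec j) (T₁c j) (T₂c j)) (rc : ∀ j, Vc j) {p q : ℕ}
  (σ : State (NEdge Ec) (NMark p T₁c) (NMark q T₂c))

/-- `Bl` at the root. -/
theorem none_mem_Bl_iff : (none : NPos Vc) ∈ (nodeZone Zc rc p q).Bl σ ↔ ∃ i, σ.2.1 (Sum.inl i) = false :=
  none_mem_markSet_nAt _ _ _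
/-- `Bl` at a child vertex. -/
theorem some_mem_Bl_iff (j : Fin d) (x : Vc j) :
    (some ⟨j, x⟩ : NPos Vc) ∈ (nodeZone Zc rc p q).Bl σ ↔ x ∈ (Zc j).Bl (restrict σ j) :=
  some_mem_markSet_nAt _ _ _ _ _
/-- `Blt` at the root. -/
theorem none_mem_Blt_iff : (none : NPos Vc) ∈ (nodeZone Zc rc p q).Blt σ ↔ ∃ i, σ.2.1 (Sum.inl i) = true :=
  none_mem_markSet_nAt _ _ _
/-- `Blt` at a child vertex. -/
theorem some_mem_Blt_iff (j : Fin d) (x : Vc j) :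
    (some ⟨j, x⟩ : NPos Vc) ∈ (nodeZone Zc rc p q).Blt σ ↔ x ∈ (Zc j).Blt (restrict σ j) :=
  some_mem_markSet_nAt _ _ _ _ _
/-- `M` at the root. -/
theorem none_mem_M_iff : (none : NPos Vc) ∈ (nodeZone Zc rc p q).M σ ↔ ∃ i, σ.2.2 (Sum.inl i) = false :=
  none_mem_markSet_nAt _ _ _
/-- `M` at a child vertex. -/
theorem some_mem_M_iff (j : Fin d) (x : Vc j) :
    (some ⟨j, x⟩ : NPos Vc) ∈ (nodeZone Zc rc p q).M σ ↔ x ∈ (Zc j).M (restrict σ j) :=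
  some_mem_markSet_nAt _ _ _ _ _
/-- `Mt` at the root. -/
theorem none_mem_Mt_iff : (none : NPos Vc) ∈ (nodeZone Zc rc p q).Mt σ ↔ ∃ i, σ.2.2 (Sum.inl i) = true :=
  none_mem_markSet_nAt _ _ _
/-- `Mt` at a child vertex. -/
theorem some_mem_Mt_iff (j : Fin d) (x : Vc j) :
    (some ⟨j, x⟩ : NPos Vc) ∈ (nodeZone Zc rc p q).Mt σ ↔ x ∈ (Zc j).Mt (restrict σ j) :=
  some_mem_markSet_nAt _ _ _ _ _

/-! ## Reaches of the node, read off the children -/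

/-- The part of a vertex set of the node inside the child `j`. -/
def childSet (S : Set (NPos Vc)) (j : Fin d) : Set (Vc j) := {x | some ⟨j, x⟩ ∈ S}

/-- Membership in `childSet`. -/
theorem mem_childSet {S : Set (NPos Vc)} {j : Fin d} {x : Vc j} : x ∈ childSet S j ↔ some ⟨j, x⟩ ∈ S := Iff.rfl

/-- The child's part of `{root}` is empty. -/
theorem childSet_singleton_none (j : Fin d) : childSet ({none} : Set (NPos Vc)) j = ∅ := by
  ext x
  simp [childSet]

variable (c : Bool)

/-- An adjacency of the child lifts to the node. -/
theorem adj_of_child {j : Fin d} {a b : Vc j} (h : (Zc j).Adj (fun _ b => b = c) (restrict σ j) a b) :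
    (nodeZone Zc rc p q).Adj (fun _ b => b = c) σ (some ⟨j, a⟩) (some ⟨j, b⟩) := by
  obtain ⟨e, he, hc⟩ := h
  refine ⟨⟨j, some e⟩, ?_, hc⟩
  rcases he with ⟨rfl, rfl⟩ | ⟨rfl, rfl⟩
  · exact Or.inl ⟨rfl, rfl⟩
  · exact Or.inr ⟨rfl, rfl⟩

/-- The edge to a child, from the root. -/
theorem adj_root_child {j : Fin d} (h : σ.1 ⟨j, none⟩ = c) :
    (nodeZone Zc rc p q).Adj (fun _ b => b = c) σ none (some ⟨j, rc j⟩) :=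
  ⟨⟨j, none⟩, Or.inl ⟨rfl, rfl⟩, h⟩

/-- The edge to a child, from the child. -/
theorem adj_child_root {j : Fin d} (h : σ.1 ⟨j, none⟩ = c) :
    (nodeZone Zc rc p q).Adj (fun _ b => b = c) σ (some ⟨j, rc j⟩) none :=
  ⟨⟨j, none⟩, Or.inr ⟨rfl, rfl⟩, h⟩

/-- A path of the child lifts to the node. -/
theorem reflTransGen_of_child {j : Fin d} {a b : Vc j}
    (h : Relation.ReflTransGen ((Zc j).Adj (fun _ b => b = c) (restrict σ j)) a b) :
    Relation.ReflTransGen ((nodeZone Zc rc p q).Adj (fun _ b => b = c) σ) (some ⟨j, a⟩) (some ⟨j, b⟩) := by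
  induction h with
  | refl => exact Relation.ReflTransGen.refl
  | tail _ h ih => exact ih.tail (adj_of_child Zc rc σ c h)

/-- A vertex reached inside a child is reached in the node. -/
theorem some_mem_reach_of_child {S : Set (NPos Vc)} {j : Fin d} {x : Vc j}
    (h : x ∈ reach ((Zc j).Adj (fun _ b => b = c) (restrict σ j)) (childSet S j)) :
    some ⟨j, x⟩ ∈ reach ((nodeZone Zc rc p q).Adj (fun _ b => b = c) σ) S := by
  obtain ⟨s, hs, hsx⟩ := h
  exact ⟨some ⟨j, s⟩, hs, reflTransGen_of_child Zc rc σ c hsx⟩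

/-- The ROOT CONDITION: the root lies in `S`, or some child root is reached inside its child from the child's part
of `S` and the edge to that child has the colour. -/
def rootReach (S : Set (NPos Vc)) : Prop :=
  none ∈ S ∨ ∃ j, σ.1 ⟨j, none⟩ = c ∧ rc j ∈ reach ((Zc j).Adj (fun _ b => b = c) (restrict σ j)) (childSet S j)

/-- The candidate reach condition, vertex by vertex. -/
def reachCond (S : Set (NPos Vc)) : NPos Vc → Prop
  | none => rootReach Zc rc σ c S
  | some ⟨j, x⟩ => x ∈ reach ((Zc j).Adj (fun _ b => b = c) (restrict σ j)) (childSet S j) ∨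
      (σ.1 ⟨j, none⟩ = c ∧ x ∈ reach ((Zc j).Adj (fun _ b => b = c) (restrict σ j)) {rc j} ∧
        rootReach Zc rc σ c S)

/-- The reach condition at a child vertex is closed under the child's adjacency. -/
theorem reachCond_tail {S : Set (NPos Vc)} {j : Fin d} {a b : Vc j} (ha : reachCond Zc rc σ c S (some ⟨j, a⟩))
    (h : (Zc j).Adj (fun _ b => b = c) (restrict σ j) a b) : reachCond Zc rc σ c S (some ⟨j, b⟩) := by
  simp only [reachCond] at ha ⊢
  rcases ha with ha | ⟨hc, ha, hr⟩
  · exact Or.inl (reach_tail ha h)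
  · exact Or.inr ⟨hc, reach_tail ha h, hr⟩

/-- The reach condition holds on the reach. -/
theorem reachCond_of_mem_reach {S : Set (NPos Vc)} {v : NPos Vc}
    (hv : v ∈ reach ((nodeZone Zc rc p q).Adj (fun _ b => b = c) σ) S) : reachCond Zc rc σ c S v := by
  refine reach_subset_of_closed (U := {v | reachCond Zc rc σ c S v}) ?_ ?_ hv
  · intro v hvS
    rcases v with _ | ⟨j, x⟩
    · exact Or.inl hvS
    · exact Or.inl (mem_reach_of_mem hvS)
  · rintro u v hu ⟨e, he, hc⟩
    rcases e with ⟨j, _ | e⟩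
    · simp only [Joins, nodeZone, nFst, nSnd] at he
      rcases he with ⟨rfl, rfl⟩ | ⟨rfl, rfl⟩
      · exact Or.inr ⟨hc, mem_reach_of_mem rfl, hu⟩
      · simp only [reachCond] at hu ⊢
        rcases hu with hu | ⟨-, -, hr⟩
        · exact Or.inr ⟨j, hc, hu⟩
        · exact hr
    · simp only [Joins, nodeZone, nFst, nSnd] at he
      rcases he with ⟨rfl, rfl⟩ | ⟨rfl, rfl⟩
      · exact reachCond_tail Zc rc σ c hu ⟨e, Or.inl ⟨rfl, rfl⟩, hc⟩
      · exact reachCond_tail Zc rc σ c hu ⟨e, Or.inr ⟨rfl, rfl⟩, hc⟩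

/-- The root condition puts the root in the reach. -/
theorem none_mem_reach_of_rootReach {S : Set (NPos Vc)} (h : rootReach Zc rc σ c S) :
    (none : NPos Vc) ∈ reach ((nodeZone Zc rc p q).Adj (fun _ b => b = c) σ) S := by
  rcases h with h | ⟨j, hc, hj⟩
  · exact mem_reach_of_mem h
  · exact reach_tail (some_mem_reach_of_child Zc rc σ c hj) (adj_child_root Zc rc σ c hc)

/-- The reach condition puts the vertex in the reach. -/
theorem mem_reach_of_reachCond {S : Set (NPos Vc)} {v : NPos Vc} (hv : reachCond Zc rc σ c S v) :
    v ∈ reach ((nodeZone Zc rc p q).Adj (fun _ b => b = c) σ) S := by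
  rcases v with _ | ⟨j, x⟩
  · exact none_mem_reach_of_rootReach Zc rc σ c hv
  · simp only [reachCond] at hv
    rcases hv with hv | ⟨hc, hx, hr⟩
    · exact some_mem_reach_of_child Zc rc σ c hv
    · obtain ⟨s, hs, hsx⟩ := hx
      rw [Set.mem_singleton_iff] at hs
      subst hs
      exact reach_trans (reach_tail (none_mem_reach_of_rootReach Zc rc σ c hr) (adj_root_child Zc rc σ c hc))
        (reflTransGen_of_child Zc rc σ c hsx)

/-- **The root is reached from `S`** iff the root condition holds. -/
theorem none_mem_reach_iff (S : Set (NPos Vc)) :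
    (none : NPos Vc) ∈ reach ((nodeZone Zc rc p q).Adj (fun _ b => b = c) σ) S ↔ rootReach Zc rc σ c S :=
  ⟨fun h => reachCond_of_mem_reach Zc rc σ c h, fun h => mem_reach_of_reachCond Zc rc σ c (v := none) h⟩

/-- **A child vertex is reached from `S`** iff it is reached inside its child from the child's part of `S`, or the
edge to its child has the colour, it is connected to the child's root and the root condition holds. -/
theorem some_mem_reach_iff (S : Set (NPos Vc)) (j : Fin d) (x : Vc j) :
    (some ⟨j, x⟩ : NPos Vc) ∈ reach ((nodeZone Zc rc p q).Adj (fun _ b => b = c) σ) S ↔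
      x ∈ reach ((Zc j).Adj (fun _ b => b = c) (restrict σ j)) (childSet S j) ∨
        (σ.1 ⟨j, none⟩ = c ∧ x ∈ reach ((Zc j).Adj (fun _ b => b = c) (restrict σ j)) {rc j} ∧
          rootReach Zc rc σ c S) :=
  ⟨fun h => reachCond_of_mem_reach Zc rc σ c h, fun h => mem_reach_of_reachCond Zc rc σ c (v := some ⟨j, x⟩) h⟩

/-- The root condition for the source `{root}` holds. -/
theorem rootReach_singleton_none : rootReach Zc rc σ c ({none} : Set (NPos Vc)) := Or.inl rfl

/-- A child vertex is reached from the root iff its edge has the colour and it is connected to the child's root. -/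
theorem some_mem_reach_singleton_none_iff (j : Fin d) (x : Vc j) :
    (some ⟨j, x⟩ : NPos Vc) ∈ reach ((nodeZone Zc rc p q).Adj (fun _ b => b = c) σ) {none} ↔
      σ.1 ⟨j, none⟩ = c ∧ x ∈ reach ((Zc j).Adj (fun _ b => b = c) (restrict σ j)) {rc j} := by
  rw [some_mem_reach_iff, childSet_singleton_none, reach_empty]
  simp only [Set.mem_empty_iff_false, false_or, rootReach_singleton_none, and_true]

end TreeNode

end ZoneZ

end PercRepro
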